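import Summits.Ventures.PercRepro.ProfileGapMonoThresholdAvgOneBounds
import Summits.Ventures.PercRepro.ProfileGapMonoRowAvg

/-!
# PercRepro — THE STRONG AVERAGED STEP (p10's `AvgStepT`, coefficient `#E − q`) IS A THEOREM AT CO-RANK `2` AT
THE OFFSETS `−1` AND `0`: `AvgStepT α 2 1` AND `AvgStepT α 2 2` (p5, gen 28; `proofs/P5-GM1.md` §31)

`Σ_{z ∈ E} Φ_t(N ∖ z) ≤ (#E − 2) · Φ_t(N)` at co-rank `2`, written without subtraction (the body of `AvgStepT α 2 t`):
* `avg_two_body_of_card_le_two` — trivial on `≤ 2` points (no rank-`2` set in a deletion, coefficient `0`);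
* `avg_step_of_loop` — at a loop `ℓ` everything doubles and one unit of `(I_t)(N ∖ ℓ)` pays the coefficient:
  `Σ_y Φ(N∖y) = Φ(N∖ℓ) + 2 Σ_{y ≠ ℓ} Φ(N∖ℓ∖y) ≤ (1 + 2 (#E − 3)) Φ(N∖ℓ) ≤ (#E − 2) · 2 Φ(N∖ℓ)`;
* `avg_two_one_of_loopless` — the charging of `ProfileGapMonoThresholdAvgOneBounds` summed over the rank-`1`
  sets, with the validity of the shares (`sum_share_le_sum_weight_wt`) and the deletion counts;
* **`avgStepT_two_one : AvgStepT α 2 1`**, and by the complement identity `Φ_{q−1} = Φ_q`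
  (`avg_pred_iff` / `avgStepT_of_pred`, every `q ≥ 1`) **`avgStepT_two_two : AvgStepT α 2 2`**.
At the offset `1` the strong step is false (`U_{2,3} ⊕ U_{2,3}`, §21(e)); the weak step
(`weakAvgStepT_two_three`) is what survives there.
-/

open scoped Matroid

namespace PercRepro.Cogirth

open Finset ThmH Skew Shadow Profile

variable {α : Type} [DecidableEq α] {N : Matroid α} [N.Finite]

section Small

/-- No rank-`2` set on a ground set of at most one point. -/
theorem levelSetCoQ_two_eq_empty_of_card_le_one (h : (gr N).card ≤ 1) (t : ℕ) : levelSetCoQ N t 2 = ∅ := by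
  ext S
  simp only [mem_levelSetCoQ, notMem_empty, iff_false]
  rintro ⟨⟨hS, hr⟩, _⟩
  have h1 := rk_le_card (M := N) S
  rw [rk_eq_of_eRk_eq_cq hr] at h1
  have := card_le_card hS
  omega

/-- The body of the strong step at co-rank `2` on at most two points: every term vanishes. -/
theorem avg_two_body_of_card_le_two (h : (gr N).card ≤ 2) (t : ℕ) :
    ∑ z ∈ gr N, 2 * (levelSetCoQ (N ＼ ({z} : Set α)) t 2).card + ((gr N).card - 2) * thresholdSum N 2 t ≤
      ((gr N).card - 2) * (2 * (levelSetCoQ N t 2).card) + ∑ z ∈ gr N, thresholdSum (N ＼ ({z} : Set α)) 2 t := by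
  have h0 : (gr N).card - 2 = 0 := by omega
  rw [h0, zero_mul, zero_mul, add_zero, zero_add]
  have hz : ∀ z ∈ gr N, 2 * (levelSetCoQ (N ＼ ({z} : Set α)) t 2).card = 0 := by
    intro z hz
    rw [levelSetCoQ_two_eq_empty_of_card_le_one _ t, card_empty, mul_zero]
    rw [gr_delete', card_erase_of_mem hz]
    omega
  rw [sum_congr rfl hz, sum_const_zero]
  exact Nat.zero_le _

end Small

section Loop

variable {t : ℕ}

/-- **The strong step at a loop** (`#E ≥ 3`): from the strong step of `N ∖ ℓ` and `(I_t)(N ∖ ℓ)`. -/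
theorem avg_step_of_loop {ℓ : α} (hℓ : ℓ ∈ gr N) (h0 : rk N {ℓ} = 0) (hn : 3 ≤ (gr N).card)
    (hI : ThresholdIneq (N ＼ ({ℓ} : Set α)) 2 t)
    (hW : ∑ z ∈ gr (N ＼ ({ℓ} : Set α)),
        2 * (levelSetCoQ ((N ＼ ({ℓ} : Set α)) ＼ ({z} : Set α)) t 2).card +
        ((gr (N ＼ ({ℓ} : Set α))).card - 2) * thresholdSum (N ＼ ({ℓ} : Set α)) 2 t ≤
      ((gr (N ＼ ({ℓ} : Set α))).card - 2) * (2 * (levelSetCoQ (N ＼ ({ℓ} : Set α)) t 2).card) +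
        ∑ z ∈ gr (N ＼ ({ℓ} : Set α)), thresholdSum ((N ＼ ({ℓ} : Set α)) ＼ ({z} : Set α)) 2 t) :
    ∑ z ∈ gr N, 2 * (levelSetCoQ (N ＼ ({z} : Set α)) t 2).card + ((gr N).card - 2) * thresholdSum N 2 t ≤
      ((gr N).card - 2) * (2 * (levelSetCoQ N t 2).card) + ∑ z ∈ gr N, thresholdSum (N ＼ ({z} : Set α)) 2 t := by
  have h1 : ∀ y ∈ (gr N).erase ℓ,
      2 * (levelSetCoQ (N ＼ ({y} : Set α)) t 2).card =
        2 * (2 * (levelSetCoQ ((N ＼ ({ℓ} : Set α)) ＼ ({y} : Set α)) t 2).card) := by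
    intro y hy
    obtain ⟨hℓy, h0y⟩ := loop_of_delete hℓ h0 hy
    rw [card_levelSetCoQ_loop hℓy h0y, card_levelSetCoQ_congr (delete_singleton_comm N y ℓ), mul_left_comm]
  have h2 : ∀ y ∈ (gr N).erase ℓ,
      thresholdSum (N ＼ ({y} : Set α)) 2 t =
        2 * thresholdSum ((N ＼ ({ℓ} : Set α)) ＼ ({y} : Set α)) 2 t := by
    intro y hy
    obtain ⟨hℓy, h0y⟩ := loop_of_delete hℓ h0 hy
    rw [thresholdSum_loop hℓy h0y, thresholdSum_congr (delete_singleton_comm N y ℓ)]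
  rw [← add_sum_erase (gr N) _ hℓ, ← add_sum_erase (gr N) _ hℓ, sum_congr rfl h1, sum_congr rfl h2]
  have hT := card_levelSetCoQ_loop hℓ h0 t 2
  have hTS := thresholdSum_loop (q := 2) (t := t) hℓ h0
  have hn' : (gr N).card = ((gr N).erase ℓ).card + 1 := by
    rw [card_erase_of_mem hℓ]
    have := card_pos.2 ⟨ℓ, hℓ⟩
    omega
  rw [gr_delete'] at hW
  unfold ThresholdIneq at hI
  rw [hT, hTS, hn']
  simp only [← mul_sum] at hW ⊢
  have hk : ((gr N).erase ℓ).card + 1 - 2 = (((gr N).erase ℓ).card - 2) + 1 := by omega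
  rw [hk]
  set K := ((gr N).erase ℓ).card - 2 with hK
  set A := (levelSetCoQ (N ＼ ({ℓ} : Set α)) t 2).card with hA
  set Bs := thresholdSum (N ＼ ({ℓ} : Set α)) 2 t with hBs
  have e1 : (K + 1) * (2 * Bs) = 2 * (K * Bs) + 2 * Bs := by ring
  have e2 : (K + 1) * (2 * (2 * A)) = 2 * (K * (2 * A)) + 2 * (2 * A) := by ring
  rw [e1, e2]
  omega

end Loop

section Loopless

/-- **The strong step at `(2, 1)` on every loopless matroid with `≥ 2` points**: the per-set bounds summed, the
validity of the shares, the deletion counts. -/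
theorem avg_two_one_of_loopless (hloop : ∀ x ∈ gr N, rk N {x} = 1) (hn : 2 ≤ (gr N).card) :
    ∑ z ∈ gr N, 2 * (levelSetCoQ (N ＼ ({z} : Set α)) 1 2).card + ((gr N).card - 2) * thresholdSum N 2 1 ≤
      ((gr N).card - 2) * (2 * (levelSetCoQ N 1 2).card) + ∑ z ∈ gr N, thresholdSum (N ＼ ({z} : Set α)) 2 1 := by
  -- the supply side: the deletion count of `T_1` with the lost sets
  have hS := sum_card_levelSetCoQ_delete_add_le (M := N) 1 2
  have hT2 : 2 * (levelSetCoQ N 1 2).card ≤ ∑ S ∈ levelSetCoQ N 1 2, S.card := by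
    rw [mul_comm, ← smul_eq_mul, ← sum_const]
    apply sum_le_sum
    intro S hS
    rw [mem_levelSetCoQ] at hS
    have h := rk_le_card (M := N) S
    rw [rk_eq_of_eRk_eq_cq hS.1.2] at h
    exact h
  have h12 : (1 : ℕ) + 1 = 2 := rfl
  have h21 : (2 : ℕ) - 1 = 1 := rfl
  -- the demand side: the per-set bounds
  have hdem : ((gr N).card - 2) * thresholdSum N 2 1 ≤
      ∑ z ∈ gr N, thresholdSum (N ＼ ({z} : Set α)) 2 1 +
        ∑ B ∈ (Rq N 1).filter (fun B => 2 ≤ rk N (gr N \ B)), ∑ y ∈ gr N \ clF N B,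
          (if B.card = 1 ∧ 2 ≤ rk N (gr N \ {y}) then 1 else 2) *
            ((insert y B).card - 2 +
              (if rk N (gr N \ insert y B) = 1 then (coloops N (gr N \ insert y B)).card else 0)) := by
    rw [sum_thresholdSum_delete_eq]
    unfold thresholdSum
    rw [mul_sum, sum_congr rfl (fun B _ => sum_threshold_erase (M := N) (X := gr N \ B) sdiff_subset 1)]
    simp only [h12, h21]
    rw [sum_filter, ← sum_add_distrib]
    apply sum_le_sum
    intro B hB
    by_cases h1 : B.card = 1
    · obtain ⟨b, rfl⟩ := card_eq_one.1 h1
      have hb : b ∈ gr N := (mem_Rq.1 hB).1 (mem_singleton_self b)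
      by_cases hP2 : 2 ≤ (clF N {b}).card
      · exact av_point_bound_singleton_big hloop hb hP2
      · have hP1 : (clF N {b}).card = 1 := by
          have : 1 ≤ (clF N {b}).card :=
            card_pos.2 ⟨b, subset_clF (singleton_subset_iff.2 hb) (mem_singleton_self b)⟩
          omega
        exact av_point_bound_singleton_small hloop hb hP1
    · have h2 : 2 ≤ B.card := by
        have : 1 ≤ B.card := by
          rw [mem_Rq] at hB
          have := rk_le_card (M := N) B
          rw [rk_eq_of_eRk_eq_cq hB.2] at this
          exact this
        omega
      exact av_point_bound_two_le hloop hB h2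
  -- the validity of the shares, with the weight `g_1`
  have hval := sum_share_le_sum_weight_wt hloop 1
    (fun S => S.card - 2 + (if rk N (gr N \ S) = 1 then (coloops N (gr N \ S)).card else 0))
  simp only [h12] at hval
  have hw : ∑ S ∈ levelSetCoQ N 1 2,
      2 * (S.card - 2 + (if rk N (gr N \ S) = 1 then (coloops N (gr N \ S)).card else 0)) =
      2 * (∑ S ∈ levelSetCoQ N 1 2, (S.card - 2) +
        ∑ S ∈ (levelSetCoQ N 1 2).filter (fun S => rk N (gr N \ S) = 1), (coloops N (gr N \ S)).card) := by
    rw [← mul_sum, sum_add_distrib, sum_filter]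
  rw [hw] at hval
  have hsz : ∑ S ∈ levelSetCoQ N 1 2, (S.card - 2) + 2 * (levelSetCoQ N 1 2).card =
      ∑ S ∈ levelSetCoQ N 1 2, S.card := by
    rw [mul_comm, ← smul_eq_mul, ← sum_const, ← sum_add_distrib]
    apply sum_congr rfl
    intro S hS
    rw [mem_levelSetCoQ] at hS
    have h := rk_le_card (M := N) S
    rw [rk_eq_of_eRk_eq_cq hS.1.2] at h
    omega
  -- assemble: `(n − 2) X = n X − 2 X`
  have h2n : 2 * (2 * (levelSetCoQ N 1 2).card) ≤ (gr N).card * (2 * (levelSetCoQ N 1 2).card) :=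
    Nat.mul_le_mul_right _ hn
  have h2t : 2 * thresholdSum N 2 1 ≤ (gr N).card * thresholdSum N 2 1 := Nat.mul_le_mul_right _ hn
  rw [Nat.sub_mul, Nat.sub_mul, Nat.mul_left_comm (gr N).card 2, ← mul_sum]
  rw [Nat.sub_mul] at hdem
  rw [Nat.mul_left_comm (gr N).card 2] at h2n
  omega

end Loopless

section Theorem

/-- The induction on `#E`: `≤ 2` points, a loop, or loopless. -/
theorem avg_two_one_aux (n : ℕ) :
    ∀ (N : Matroid α) [N.Finite], (gr N).card = n →
      ∑ z ∈ gr N, 2 * (levelSetCoQ (N ＼ ({z} : Set α)) 1 2).card + ((gr N).card - 2) * thresholdSum N 2 1 ≤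
        ((gr N).card - 2) * (2 * (levelSetCoQ N 1 2).card) + ∑ z ∈ gr N, thresholdSum (N ＼ ({z} : Set α)) 2 1 := by
  induction n using Nat.strong_induction_on with
  | _ n ih =>
  intro N _ hN
  by_cases hsmall : (gr N).card ≤ 2
  · exact avg_two_body_of_card_le_two hsmall 1
  · by_cases hloop : ∃ ℓ ∈ gr N, rk N {ℓ} = 0
    · obtain ⟨ℓ, hℓ, h0⟩ := hloop
      have hlt : ((gr N).erase ℓ).card < n := by rw [← hN]; exact card_erase_lt_of_mem hℓ
      have hW := ih _ hlt (N ＼ ({ℓ} : Set α)) (by rw [gr_delete'])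
      exact avg_step_of_loop hℓ h0 (by omega) (thresholdIneq_two _ (by norm_num)) hW
    · have hloop' : ∀ x ∈ gr N, rk N {x} = 1 := by
        intro x hx
        have h2 : rk N {x} ≠ 0 := fun h => hloop ⟨x, hx, h⟩
        have h3 : rk N {x} ≤ 1 := by
          have := rk_le_card (M := N) ({x} : Finset α)
          simpa using this
        omega
      exact avg_two_one_of_loopless hloop' (by omega)

/-- **THE STRONG AVERAGED STEP AT `(q, t) = (2, 1)` IS A THEOREM**: `AvgStepT α 2 1` — on every finite matroid,
`Σ_{z ∈ E} Φ_1(N ∖ z) ≤ (#E − 2) · Φ_1(N)` at co-rank `2` (the size hypothesis of `AvgStepT` is not used). -/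
theorem avgStepT_two_one : AvgStepT α 2 1 := fun N _ _ => avg_two_one_aux _ N rfl

end Theorem

section Pred

variable {q : ℕ}

/-- **The strong steps at the offsets `−1` and `0` coincide at every matroid** (`1 ≤ q`): the complement identity
`Φ_{q−1} = Φ_q` adds the same correction `q · #{B : ρ(B) = q − 1, ρ(E∖B) = q}` to both sides, for `N` and for every
`N ∖ z`. -/
theorem avg_pred_iff (hq : 1 ≤ q) (N : Matroid α) [N.Finite] :
    (∑ z ∈ gr N, q * (levelSetCoQ (N ＼ ({z} : Set α)) (q - 1) q).card +
        ((gr N).card - q) * thresholdSum N q (q - 1) ≤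
      ((gr N).card - q) * (q * (levelSetCoQ N (q - 1) q).card) +
        ∑ z ∈ gr N, thresholdSum (N ＼ ({z} : Set α)) q (q - 1)) ↔
    (∑ z ∈ gr N, q * (levelSetCoQ (N ＼ ({z} : Set α)) q q).card + ((gr N).card - q) * thresholdSum N q q ≤
      ((gr N).card - q) * (q * (levelSetCoQ N q q).card) + ∑ z ∈ gr N, thresholdSum (N ＼ ({z} : Set α)) q q) := by
  have h1 : ∀ z ∈ gr N, q * (levelSetCoQ (N ＼ ({z} : Set α)) (q - 1) q).card =
      q * (levelSetCoQ (N ＼ ({z} : Set α)) q q).card +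
        q * ((Rq (N ＼ ({z} : Set α)) (q - 1)).filter
          (fun B => rk (N ＼ ({z} : Set α)) (gr (N ＼ ({z} : Set α)) \ B) = q)).card := by
    intro z _
    rw [card_levelSetCoQ_pred_eq_add hq, mul_add]
  have h2 : ∀ z ∈ gr N, thresholdSum (N ＼ ({z} : Set α)) q (q - 1) =
      thresholdSum (N ＼ ({z} : Set α)) q q +
        q * ((Rq (N ＼ ({z} : Set α)) (q - 1)).filter
          (fun B => rk (N ＼ ({z} : Set α)) (gr (N ＼ ({z} : Set α)) \ B) = q)).card := by
    intro z _
    rw [thresholdSum_pred_eq_add hq]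
  rw [sum_congr rfl h1, sum_congr rfl h2, sum_add_distrib, sum_add_distrib,
    thresholdSum_pred_eq_add (N := N) hq, card_levelSetCoQ_pred_eq_add (N := N) hq, mul_add, mul_add, mul_add]
  constructor <;> intro h <;> linarith

/-- **`AvgStepT` at the offset `0` from the offset `−1`** (`1 ≤ q`; the size hypothesis of `AvgStepT` only grows). -/
theorem avgStepT_of_pred (hq : 1 ≤ q) (h : AvgStepT α q (q - 1)) : AvgStepT α q q := by
  unfold AvgStepT at h ⊢
  intro N _ hn
  exact (avg_pred_iff hq N).1 (h N (by omega))

/-- **THE STRONG AVERAGED STEP AT `(q, t) = (2, 2)` IS A THEOREM**: `AvgStepT α 2 2` (the offset `0` of co-rank `2`,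
the row `(1, 2)`), from `avgStepT_two_one` by the complement identity. -/
theorem avgStepT_two_two : AvgStepT α 2 2 :=
  avgStepT_of_pred (α := α) (q := 2) (by norm_num) avgStepT_two_one

/-- `(I_1)` and `(I_2)` at co-rank `2` through p10's route `thresholdIneq_of_avgStepT` (the base `#E ≤ t + 2` is
`thresholdIneq_two`). -/
theorem thresholdIneq_two_one_of_avg (N : Matroid α) [N.Finite] : ThresholdIneq N 2 1 :=
  thresholdIneq_of_avgStepT avgStepT_two_one (fun M _ _ => thresholdIneq_two M (by norm_num)) N

/-- `(I_2)` at co-rank `2` through p10's route. -/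
theorem thresholdIneq_two_two_of_avg (N : Matroid α) [N.Finite] : ThresholdIneq N 2 2 :=
  thresholdIneq_of_avgStepT avgStepT_two_two (fun M _ _ => thresholdIneq_two M (by norm_num)) N

end Pred

end PercRepro.Cogirth
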